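import Summits.BirchSwinnertonDyer.BirchSwinnertonDyer.Theorems.EisensteinPrimesAcTwistDeformationSurAtVbarOfDatum
import Summits.BirchSwinnertonDyer.BirchSwinnertonDyer.Theorems.EisensteinPrimesAcTwistDeformationCurveSUROfTate
import Summits.BirchSwinnertonDyer.BirchSwinnertonDyer.Theorems.EisensteinPrimesAcTwistDeformationSurAtVbarOfTate
import Literature.NumberTheory.IwasawaTheory.Greenberg2006.CohomologyCofiniteGenerationLeTwoOfTate
import HarnessLib

/-!
# T28 re-typing (`OfTate`) of `EisensteinPrimesAcTwistDeformationSurAtVbarOfDatum.lean`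

Route `EisensteinPrimes` (rung K5), crux 2 `GoodLatticeBDPValue` (stmt-BirchSwinnertonDyer-19032), line `halves`;
cell `bsd-eis`, seat `bsd-line-x1-p1` LEAD g8, lane «T28 / TATE RE-PLUMB» (helper, `--supports`).

This file re-types, token for token, the theorems of `EisensteinPrimesAcTwistDeformationSurAtVbarOfDatum` that carry
Greenberg 2006 Prop. 3.2 BY NAME (`h32 : (∀ (L : Type) [Field L] [NumberField L], Literature.NumberTheory.GaloisCohomology.tateGlobalEulerPoincareCharacteristic L)`, cofinite generation of
`Hⁱ(K_Σ/K, 𝒟)` / `Hⁱ(K_v, 𝒟)` for EVERY `i`, every number field, every prime) with that hypothesis replaced by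
Tate's global Euler–Poincaré characteristic BY NAME for every number field
(`h32 : ∀ L, GaloisCohomology.tateGlobalEulerPoincareCharacteristic L`, Milne ADT I Thm. 5.1): on this line
Prop. 3.2 is read in degrees `i ≤ 2` only (global clause; the local clause is the unconditional
`Greenberg2006.prop32_local_holds`), and in those degrees it follows from Tate's formula alone
(`Greenberg2006.prop32_global_le_two_of_tate`, file `CohomologyCofiniteGenerationLeTwoOfTate`: `H⁰`/`H¹` of
`G_{K,S}` with finite coefficients are finite unconditionally, `H²` by Tate, and Greenberg's dévissage for `Hⁿ`
involves `Hⁿ`, `Hⁿ⁻¹` only).  Statements are otherwise VERBATIM (same binder order, new names `<name>_ofTate`);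
proofs are the tree proofs with the two reading lemmas substituted and the re-typed callees called.
EFFECT for the crux: Harari Thm. 17.13 (a) (`poitouTate_restricted_three_le`) is no longer consumed through
Prop. 3.2 at every number field, only at totally complex fields (Greenberg 2006 Prop. 4.1 is typed totally
imaginary; `cd_p ≤ 2` and the `H²` bookkeeping at the imaginary quadratic `K`), which is what the tree's
class-formation road (`RestrictedRamificationCdTwoOfH3Mu`, lane PT3-TC) proves.

Theorems only; no definition, no named fact, no `sorry`, no instance. HONEST FRAMING: conditional on the PUBLISHED
named facts carried as hypotheses; closes nothing by itself; no summit statement / BSD / the crux is proved here.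

## References
* R. Greenberg, *On the structure of certain Galois cohomology groups*, Doc. Math. Extra Vol. Coates (2006), Prop. 3.2 (p. 358). [Greenberg2006]
* J. S. Milne, *Arithmetic Duality Theorems*, 2nd ed. (2006), I Thm. 5.1 (p. 67). [MilneADT2006]
* (the references of the re-typed file apply verbatim)
-/

set_option autoImplicit false

noncomputable section

open scoped Classical
open NumberField IsDedekindDomain Field Multiplicative PowerSeries WeierstrassCurve
open Literature.NumberTheory.EllipticCurves Literature.NumberTheory.EllipticCurves.GreenbergSelmer
  Literature.NumberTheory.EllipticCurves.GreenbergVatsal2000 Literature.NumberTheory.GaloisRepresentations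
  Literature.NumberTheory.EllipticCurves.KellerYin2024 Literature.NumberTheory.EllipticCurves.IwasawaDual
  Literature.NumberTheory.EllipticCurves.Castella2018.AcSelmer
  Literature.NumberTheory.IwasawaTheory Literature.NumberTheory.IwasawaTheory.Greenberg2016
  Literature.NumberTheory.IwasawaTheory.Greenberg2006
  Summit.BirchSwinnertonDyer.BirchSwinnertonDyer.Theorems.GreenbergFullAtSelmer
  Summit.BirchSwinnertonDyer.BirchSwinnertonDyer.Theorems.AcTwistDeformationResidualPair
  Summit.BirchSwinnertonDyer.BirchSwinnertonDyer.Theorems.TwistDeformationCofree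

namespace Summit.BirchSwinnertonDyer.BirchSwinnertonDyer.Theorems.AcTwistDeformation

section SurAtVbarOfDatum

variable {K : Type} [Field K] [NumberField K] {p : ℕ} [Fact p.Prime]

/-- **[T28 `OfTate` re-typing: Greenberg 2006 Prop. 3.2 by name ↦ Milne ADT I Thm. 5.1 by name (Prop. 3.2 is read in degrees ≤ 2 only, `prop32_global_le_two_of_tate`).]** [cite: MilneADT2006, I Thm. 5.1 (p. 67)] **S1 = SUR_θ AT `v̄` FROM ONE FINITELY GENERATED TORSION DUAL DATUM AT `S₀ = Sf`.** For
`θ ∈ {θsub, θquot}` of a residual pair of `E[p]` over the imaginary quadratic `K` ((Heeg) for `N_E`,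
`2 < p = v v̄`), `κ` anticyclotomic with topological generator `γ`, `Sf` the places over `N_E`, ONE
`D : DatumDualData κ γ (charModule ∅ θ) (bdpData …) ↑Sf` with `D.X` finitely generated and torsion (the glue's
`hfgSsub htorSsub` / `hfgSquot htorSquot`), the five Greenberg facts by name, and any `c` with
`κ(D_v̄) = p^c ℤ_p` exactly: for every `y : ℕ → H¹(ker κ ⊓ D_v̄, (F/𝒪)(θ))` there is
`u ∈ unramifiedOutside κ.kerSubgroup (F/𝒪)(θ) p ↑Sf`, locally trivial above every `w ∈ Sf`, `w ∤ p`, with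
`res_{ker κ ⊓ D_v̄}(conj_{γ^i} u) = y i` for all `i < p^c`. Proof = p642242 §2 with the [RH]-transport
replaced by `hasCorank_fullAtSelmer_zero_of_datumDualData_at ↑Sf D`.
[cite: Greenberg2016Selmer, Prop. 2.6.3 (c), §4.3 pp. 20–21] [cite: Greenberg2006, Thm. 3 p. 342, Props. 3.2, 4.1, 4.2, §5 A]
[cite: KellerYin2024, Rem. 1.2.3 (ii), Rem. 1.4.2 (arXiv:2402.12781v2 TeX L676–712, L1130–1140)] -/
theorem char_exists_forall_resOfLe_conjH1_pow_eq_at_vbar_of_datum_ofTate (h263 : prop263_sur_of_crk)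
    (h41 : prop41_globalEulerPoincareCorank) (h42 : prop42_localEulerPoincareCorank)
    (h5A : sec5A_localH2_subsingleton_of_LOC1) (h32 : (∀ (L : Type) [Field L] [NumberField L], Literature.NumberTheory.GaloisCohomology.tateGlobalEulerPoincareCharacteristic L))
    (W : WeierstrassCurve ℚ) [W.IsElliptic] (hp : 2 < p) (hK : IsImaginaryQuadratic K)
    (hH : SatisfiesHeegnerHypothesis (W.conductorNorm ℤ) K)
    {ι : K →+* ℚ_[p]} {v vbar : HeightOneSpectrum (𝓞 K)}
    (hvι : ∀ x : 𝓞 K, x ∈ v.asIdeal ↔ ‖ι (x : K)‖ < 1)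
    (hvbar : ((p : ℕ) : 𝓞 K) ∈ vbar.asIdeal) (hne : vbar ≠ v)
    (κ : ZpExtension K p) (hκ : κ.IsAnticyclotomic) (γ : absoluteGaloisGroup K)
    [Fact (κ.IsTopGenerator γ)]
    {θsub θquot : FramedGaloisRep K (padicCoeffIntegers (∅ : Set (PadicAlgCl p))) 1}
    (hpair : IsResidualPairOver (W.baseChange K) p θsub θquot)
    (Sf : Finset (HeightOneSpectrum (𝓞 K)))
    (hSf : ∀ w : HeightOneSpectrum (𝓞 K), w ∈ Sf ↔ ((W.conductorNorm ℤ : ℤ) : 𝓞 K) ∈ w.asIdeal)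
    (θ : FramedGaloisRep K (padicCoeffIntegers (∅ : Set (PadicAlgCl p))) 1) (hθ : θ = θsub ∨ θ = θquot)
    (D : DatumDualData κ γ (charModule (∅ : Set (PadicAlgCl p)) θ)
      (Castella2018.AcSelmer.bdpData (charModule (∅ : Set (PadicAlgCl p)) θ) p vbar) (↑Sf : Set (HeightOneSpectrum (𝓞 K))))
    (hDfin : Module.Finite (IwasawaAlgebra p) D.X) (hDtor : Module.IsTorsion (IwasawaAlgebra p) D.X)
    (c : ℕ) (hc : ∃ δ ∈ decomp (K := K) vbar, (κ δ).toAdd = (p : ℤ_[p]) ^ c)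
    (hcd : ∀ δ ∈ decomp (K := K) vbar, (p : ℤ_[p]) ^ c ∣ (κ δ).toAdd) :
      ∀ y : ℕ → subgroupH1 (κ.kerSubgroup ⊓ decomp (K := K) vbar) (charModule (∅ : Set (PadicAlgCl p)) θ),
        ∃ u ∈ unramifiedOutside κ.kerSubgroup (charModule (∅ : Set (PadicAlgCl p)) θ) p
            (↑Sf : Set (HeightOneSpectrum (𝓞 K))),
          (∀ w ∈ Sf, ((p : ℕ) : 𝓞 K) ∉ w.asIdeal → ∀ σ : absoluteGaloisGroup K,
            conjH1 κ.kerSubgroup (charModule (∅ : Set (PadicAlgCl p)) θ) σ u ∈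
              awayKer κ.kerSubgroup (charModule (∅ : Set (PadicAlgCl p)) θ) w) ∧
          ∀ i : ℕ, i < p ^ c →
            resOfLe (charModule (∅ : Set (PadicAlgCl p)) θ)
              (inf_le_left : κ.kerSubgroup ⊓ decomp (K := K) vbar ≤ κ.kerSubgroup)
              (conjH1 κ.kerSubgroup (charModule (∅ : Set (PadicAlgCl p)) θ) (γ ^ i) u) = y i := by
  have hγ : κ.IsTopGenerator γ := Fact.out
  have hv : ((p : ℕ) : 𝓞 K) ∈ v.asIdeal := IwasawaTwoVariable.natCast_mem_asIdeal_of_norm_iff hvι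
  have hSp : ∀ w : HeightOneSpectrum (𝓞 K), ((p : ℕ) : 𝓞 K) ∈ w.asIdeal → w = v ∨ w = vbar :=
    fun w hw ↦ eq_or_eq_of_natCast_mem_of_ne hK.1 hv hvbar hne hw
  intro y
  -- the target family, supported at `v̄`
  let y' : ∀ w : HeightOneSpectrum (𝓞 K), ℕ →
      subgroupH1 (κ.kerSubgroup ⊓ decomp (K := K) w) (charModule (∅ : Set (PadicAlgCl p)) θ) :=
    fun w i ↦ if hw : w = vbar then hw ▸ y i else 0
  have hy' : ∀ i : ℕ, y' vbar i = y i := fun i ↦ by simp [y']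
  -- the representatives `γ^i` of the places above `v̄`: `κ(γ^i) = i`
  have hσrep : ∀ w ∈ ({vbar} : Finset (HeightOneSpectrum (𝓞 K))), ∀ i : ℕ, i < p ^ (fun _ ↦ c) w →
      (κ ((fun (_ : HeightOneSpectrum (𝓞 K)) (i : ℕ) ↦ γ ^ i) w i)).toAdd = (i : ℤ_[p]) := fun w _ i _ ↦ by
    change (κ (γ ^ i)).toAdd = (i : ℤ_[p])
    rw [map_pow, show κ γ = Multiplicative.ofAdd 1 from hγ, ← ofAdd_nsmul, toAdd_ofAdd, nsmul_one]
  -- `S = {v, v̄} ∪ Sf`; `θ` is unramified outside `S`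
  have hS : ∀ w : HeightOneSpectrum (𝓞 K), ((p : ℕ) : 𝓞 K) ∈ w.asIdeal →
      w ∈ (↑(insert v (insert vbar Sf)) : Set (HeightOneSpectrum (𝓞 K))) :=
    mem_insert_insert_of_natCast_mem hK hv hvbar hne Sf
  have hSfS : ∀ w ∈ Sf, w ∈ (↑(insert v (insert vbar Sf)) : Set (HeightOneSpectrum (𝓞 K))) :=
    fun w hw ↦ by
    rw [Finset.coe_insert, Finset.coe_insert]
    exact Or.inr (Or.inr (Finset.mem_coe.mpr hw))
  have h : ramificationSubgroup K (↑(insert v (insert vbar Sf)) : Set (HeightOneSpectrum (𝓞 K))) ≤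
      (unitChar θ).toMonoidHom.ker :=
    ramificationSubgroup_le_ker_unitChar_of_residualPair W hpair Sf hSf _ hSfS hS θ hθ
  -- the canonical (discrete) topological instances of the model
  letI tΛ : TopologicalSpace (PowerSeries ℤ_[p]) := ⊥
  haveI : DiscreteTopology (PowerSeries ℤ_[p]) := ⟨rfl⟩
  haveI : IsTopologicalRing (PowerSeries ℤ_[p]) := inferInstance
  haveI hAdisc : DiscreteTopology (QpModZp p) := QpModZp.discreteTopology p
  haveI : IsTopologicalAddGroup (BigRepModule ℤ_[p] p (QpModZp p)) := inferInstance
  haveI : ContinuousSMul (PowerSeries ℤ_[p]) (BigRepModule ℤ_[p] p (QpModZp p)) := inferInstance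
  -- the model `ρ_θ` on `ℚ_p/ℤ_p`, `ψ = (charModuleEquiv θ)⁻¹`, the Shapiro descent `F`, and [RH]
  have hψ := charModuleEquiv_symm_galois (↑(insert v (insert vbar Sf)) : Set (HeightOneSpectrum (𝓞 K))) θ h
  obtain ⟨F, hF⟩ := exists_shapiroDescent _ hS κ (characterRepUnramified _ θ h) (charModuleEquiv θ).symm hψ
  obtain ⟨hSel, hSelfg⟩ := hasCorank_fullAtSelmer_zero_of_datumDualData_at _ hS κ
    (characterRepUnramified _ θ h) (charModuleEquiv θ).symm hψ (↑Sf : Set (HeightOneSpectrum (𝓞 K)))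
    (fun b ↦ QpModZp.exists_pow_nsmul_eq_zero b) (exists_pow_smul_cofree_eq_zero (∅ : Set (PadicAlgCl p)) θ)
    (isOpen_stabilizer_cofree (∅ : Set (PadicAlgCl p)) θ) hγ hv hne hSp D hDfin hDtor
  -- §1 with `S₀ = {v̄}`
  have hvbarS : ∀ w ∈ ({vbar} : Finset (HeightOneSpectrum (𝓞 K))),
      w ∈ (↑(insert v (insert vbar Sf)) : Set (HeightOneSpectrum (𝓞 K))) := fun w hw ↦ by
    rw [Finset.mem_singleton] at hw
    subst hw
    exact hS w hvbar
  have hvbarv : ∀ w ∈ ({vbar} : Finset (HeightOneSpectrum (𝓞 K))), w ≠ v := fun w hw ↦ by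
    rw [Finset.mem_singleton] at hw
    subst hw
    exact hne
  obtain ⟨u, hunr, haway, hev⟩ := exists_mem_unramifiedOutside_forall_resOfLe_conjH1_eq_ofTate _ hS κ
    (characterRepUnramified _ θ h) (charModuleEquiv θ).symm hψ h263 h41 h42 h5A h32 (Finset.finite_toSet _) hK
    (LinearEquiv.refl ℤ_[p] (QpModZp p)) (characterRepUnramified_hscalar _ θ h)
    (exists_local_apply_ne_one_of_mem_insert_insert hK hp hH κ hκ hv hvbar Sf hSf)
    hne hv hvbar hSel hSelfg (fun b ↦ QpModZp.exists_pow_nsmul_eq_zero b) hF {vbar} hvbarS hvbarv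
    (fun _ ↦ c) (fun w hw ↦ by rw [Finset.mem_singleton] at hw; subst hw; exact hcd)
    (fun w hw ↦ by rw [Finset.mem_singleton] at hw; subst hw; exact hc) (fun _ i ↦ γ ^ i) hσrep y'
  refine ⟨u, ?_, fun w hw hpw σ ↦ ?_, fun i hi ↦ (hev vbar (Finset.mem_singleton_self vbar) i hi).trans (hy' i)⟩
  · -- unramified outside `{v̄} ∪ {w ∣ p}` ⇒ unramified outside `Sf ∪ {w ∣ p}`
    rw [mem_unramifiedOutside_iff] at hunr ⊢
    intro w _ hpw σ
    exact hunr w (fun hw ↦ hpw (by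
      rw [Finset.coe_singleton, Set.mem_singleton_iff] at hw
      exact hw ▸ hvbar)) hpw σ
  · -- locally trivial above `w ∈ Sf`, `w ∤ p` (so `w ≠ v, v̄`)
    refine haway w (hSfS w hw) (fun h' ↦ hpw (h' ▸ hv)) (fun hw' ↦ ?_) σ
    rw [Finset.mem_singleton] at hw'
    exact hpw (hw' ▸ hvbar)

/-- **[T28 `OfTate` re-typing: Greenberg 2006 Prop. 3.2 by name ↦ Milne ADT I Thm. 5.1 by name (Prop. 3.2 is read in degrees ≤ 2 only, `prop32_global_le_two_of_tate`).]** [cite: MilneADT2006, I Thm. 5.1 (p. 67)] **S2 = SUR_f AT `v̄` FROM THE COTORSION OF `X_ac^{Sf}(E/K_∞)`.** For `E = W/ℚ` over the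
imaginary quadratic `K` ((Heeg) for `N_E`, `2 < p = v v̄`), `κ` anticyclotomic with topological generator
`γ`, `Sf` the places over `N_E`, `Module.Finite ∧ IsTorsion (XAc (W.baseChange K) p κ v̄ ↑Sf γ)` (the glue's
`hfgS htorS`), the five Greenberg facts by name, and any `c` with `κ(D_v̄) = p^c ℤ_p` exactly: for every
`y : ℕ → H¹(ker κ ⊓ D_v̄, E_K[p^∞])` there is `u ∈ unramifiedOutside κ.kerSubgroup (E_K.geomPrimaryTorsion p) p ↑Sf`,
locally trivial above every `w ∈ Sf`, `w ∤ p`, with `res_{ker κ ⊓ D_v̄}(conj_{γ^i} u) = y i` for all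
`i < p^c`. Proof = p646772 with the transport `hasCorank_fullAtSelmer_zero_of_xAc_at ↑Sf`; no residual pair
enters. [cite: Greenberg2016Selmer, Prop. 2.6.3 (c), §4.3 pp. 20–21] [cite: Greenberg2006, Thm. 3 p. 342, Props. 3.2, 4.1, 4.2, §5 A]
[cite: Castella2018, §2.2 Def. 2.2] [cite: KellerYin2024, Rem. 1.4.2 (arXiv:2402.12781v2 TeX L1130–1140)] -/
theorem curve_exists_forall_resOfLe_conjH1_pow_eq_at_vbar_of_xAc_ofTate (h263 : prop263_sur_of_crk)
    (h41 : prop41_globalEulerPoincareCorank) (h42 : prop42_localEulerPoincareCorank)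
    (h5A : sec5A_localH2_subsingleton_of_LOC1) (h32 : (∀ (L : Type) [Field L] [NumberField L], Literature.NumberTheory.GaloisCohomology.tateGlobalEulerPoincareCharacteristic L))
    (W : WeierstrassCurve ℚ) [W.IsElliptic] (hp : 2 < p) (hK : IsImaginaryQuadratic K)
    (hH : SatisfiesHeegnerHypothesis (W.conductorNorm ℤ) K)
    {ι : K →+* ℚ_[p]} {v vbar : HeightOneSpectrum (𝓞 K)}
    (hvι : ∀ x : 𝓞 K, x ∈ v.asIdeal ↔ ‖ι (x : K)‖ < 1)
    (hvbar : ((p : ℕ) : 𝓞 K) ∈ vbar.asIdeal) (hne : vbar ≠ v)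
    (κ : ZpExtension K p) (hκ : κ.IsAnticyclotomic) (γ : absoluteGaloisGroup K)
    [hγ : Fact (κ.IsTopGenerator γ)]
    (Sf : Finset (HeightOneSpectrum (𝓞 K)))
    (hSf : ∀ w : HeightOneSpectrum (𝓞 K), w ∈ Sf ↔ ((W.conductorNorm ℤ : ℤ) : 𝓞 K) ∈ w.asIdeal)
    (hXfin : Module.Finite (IwasawaAlgebra p)
      (XAc (W.baseChange K) p κ vbar (↑Sf : Set (HeightOneSpectrum (𝓞 K))) γ))
    (hXtor : Module.IsTorsion (IwasawaAlgebra p)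
      (XAc (W.baseChange K) p κ vbar (↑Sf : Set (HeightOneSpectrum (𝓞 K))) γ))
    (c : ℕ) (hc : ∃ δ ∈ decomp (K := K) vbar, (κ δ).toAdd = (p : ℤ_[p]) ^ c)
    (hcd : ∀ δ ∈ decomp (K := K) vbar, (p : ℤ_[p]) ^ c ∣ (κ δ).toAdd) :
      ∀ y : ℕ → subgroupH1 (κ.kerSubgroup ⊓ decomp (K := K) vbar) ((W.baseChange K).geomPrimaryTorsion p),
        ∃ u ∈ unramifiedOutside κ.kerSubgroup ((W.baseChange K).geomPrimaryTorsion p) p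
            (↑Sf : Set (HeightOneSpectrum (𝓞 K))),
          (∀ w ∈ Sf, ((p : ℕ) : 𝓞 K) ∉ w.asIdeal → ∀ σ : absoluteGaloisGroup K,
            conjH1 κ.kerSubgroup ((W.baseChange K).geomPrimaryTorsion p) σ u ∈
              awayKer κ.kerSubgroup ((W.baseChange K).geomPrimaryTorsion p) w) ∧
          ∀ i : ℕ, i < p ^ c →
            resOfLe ((W.baseChange K).geomPrimaryTorsion p)
              (inf_le_left : κ.kerSubgroup ⊓ decomp (K := K) vbar ≤ κ.kerSubgroup)
              (conjH1 κ.kerSubgroup ((W.baseChange K).geomPrimaryTorsion p) (γ ^ i) u) = y i := by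
  haveI hEK : (W.baseChange K).IsElliptic := inferInstanceAs (W.map (algebraMap ℚ K)).IsElliptic
  have hv : ((p : ℕ) : 𝓞 K) ∈ v.asIdeal := IwasawaTwoVariable.natCast_mem_asIdeal_of_norm_iff hvι
  intro y
  -- `S = {v, v̄} ∪ Sf` contains the places above `p` and the bad places of `E_K`
  set S : Set (HeightOneSpectrum (𝓞 K)) := (↑(insert v (insert vbar Sf)) : Set (HeightOneSpectrum (𝓞 K)))
    with hSdef
  have hS : ∀ w : HeightOneSpectrum (𝓞 K), ((p : ℕ) : 𝓞 K) ∈ w.asIdeal → w ∈ S :=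
    mem_insert_insert_of_natCast_mem hK hv hvbar hne Sf
  have hSfS : ∀ w ∈ Sf, w ∈ S := fun w hw ↦ by
    rw [hSdef, Finset.coe_insert, Finset.coe_insert]
    exact Or.inr (Or.inr (Finset.mem_coe.mpr hw))
  have hgoodN : ∀ w : HeightOneSpectrum (𝓞 K), w ∉ Sf → (W.baseChange K).HasGoodReductionAt w := fun w hw ↦
    EisensteinPrimesMuLambda.hasGoodReductionAt_baseChange_of_conductorNorm_notMem W w fun h ↦ hw ((hSf w).mpr h)
  have hSbad : ∀ w : HeightOneSpectrum (𝓞 K), ¬ (W.baseChange K).HasGoodReductionAt w → w ∈ S :=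
    fun w hw ↦ hSfS w (by_contra fun hw' ↦ hw (hgoodN w hw'))
  have hgood : ∀ w : HeightOneSpectrum (𝓞 K), w ∉ S → ((p : ℕ) : 𝓞 K) ∉ w.asIdeal →
      (W.baseChange K).HasGoodReductionAt w := fun w hw _ ↦ hgoodN w fun h ↦ hw (hSfS w h)
  -- the model `ρ₀` of `E_K[p^∞]` over `G_{K,S}` (Néron–Ogg–Shafarevich)
  have hNS : ∀ n ∈ ramificationSubgroup K S, ∀ P : PrimaryTorsion (W.baseChange K).geomPoints p, n • P = P :=
    fun n hn P ↦ SignedBaseChangeAcDivCurveModel.smul_primaryTorsion_eq_of_mem_ramificationSubgroup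
      (W.baseChange K) p S hSbad hS hn P
  obtain ⟨ρ₀, hρ₀⟩ := SignedBaseChangeAcDivCurveModel.exists_continuousRep_primaryTorsion (W.baseChange K) p S hNS
  -- the canonical (discrete) topological instances of the arena
  letI tΛ : TopologicalSpace (PowerSeries ℤ_[p]) := ⊥
  haveI : DiscreteTopology (PowerSeries ℤ_[p]) := ⟨rfl⟩
  haveI : IsTopologicalRing (PowerSeries ℤ_[p]) := inferInstance
  haveI : IsTopologicalAddGroup (BigRepModule ℤ_[p] p (PrimaryTorsion (W.baseChange K).geomPoints p)) :=
    inferInstance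
  haveI : ContinuousSMul (PowerSeries ℤ_[p]) (BigRepModule ℤ_[p] p (PrimaryTorsion (W.baseChange K).geomPoints p)) :=
    inferInstance
  -- `K` imaginary quadratic
  haveI := hK.2
  have hKc : ∀ w : InfinitePlace K, w.IsComplex := IsTotallyComplex.isComplex
  -- `corank_Λ S_{𝓛_v}(K, 𝐃_E) = 0` from the cotorsion of `X_ac^{Sf}`
  obtain ⟨hSel, -⟩ := hasCorank_fullAtSelmer_zero_of_xAc_at S (W.baseChange K) hS κ ρ₀
    (↑Sf : Set (HeightOneSpectrum (𝓞 K))) hρ₀ hKc hv hvbar hne hgood hXfin hXtor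
  -- SUR(`𝐃_E`, `𝓛_v`)
  have hSUR := primaryTorsion_fullAt_SUR_ofTate (W.baseChange K) hS κ ρ₀ h263 h41 h42 h5A h32 (Finset.finite_toSet _)
    hK (exists_local_apply_ne_one_of_mem_insert_insert hK hp hH κ hκ hv hvbar Sf hSf) hne hv hvbar hSel
  -- the Shapiro descent with `ψ = id`
  let ψ : PrimaryTorsion (W.baseChange K).geomPoints p ≃+ (W.baseChange K).geomPrimaryTorsion p :=
    AddEquiv.refl _
  have hψ : ∀ (σ : absoluteGaloisGroup K) (a : PrimaryTorsion (W.baseChange K).geomPoints p),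
      ψ (ρ₀ (toUnramifiedQuot K S σ) a) = σ • ψ a := fun σ a ↦ by rw [hρ₀]; rfl
  have hA : ∀ a : PrimaryTorsion (W.baseChange K).geomPoints p, ∃ k : ℕ, p ^ k • a = 0 := fun a ↦ by
    obtain ⟨k, hk⟩ := a.exists_pow_smul_eq_zero
    exact ⟨k, PrimaryTorsion.ext (by rw [PrimaryTorsion.val_nsmul]; exact hk)⟩
  obtain ⟨F, hF⟩ := exists_shapiroDescent S hS κ ρ₀ ψ hψ
  -- the target family, supported at `v̄`; representatives `γ^i`
  let y' : ∀ w : HeightOneSpectrum (𝓞 K), ℕ →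
      subgroupH1 (κ.kerSubgroup ⊓ decomp (K := K) w) ((W.baseChange K).geomPrimaryTorsion p) :=
    fun w i ↦ if hw : w = vbar then hw ▸ y i else 0
  have hy' : ∀ i : ℕ, y' vbar i = y i := fun i ↦ by simp [y']
  have hσrep : ∀ w ∈ ({vbar} : Finset (HeightOneSpectrum (𝓞 K))), ∀ i : ℕ, i < p ^ (fun _ ↦ c) w →
      (κ ((fun (_ : HeightOneSpectrum (𝓞 K)) (i : ℕ) ↦ γ ^ i) w i)).toAdd = (i : ℤ_[p]) := fun w _ i _ ↦ by
    change (κ (γ ^ i)).toAdd = (i : ℤ_[p])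
    rw [map_pow, show κ γ = Multiplicative.ofAdd 1 from hγ.out, ← ofAdd_nsmul, toAdd_ofAdd, nsmul_one]
  have hvbarS : ∀ w ∈ ({vbar} : Finset (HeightOneSpectrum (𝓞 K))), w ∈ S := fun w hw ↦ by
    rw [Finset.mem_singleton] at hw
    subst hw
    exact hS w hvbar
  have hvbarv : ∀ w ∈ ({vbar} : Finset (HeightOneSpectrum (𝓞 K))), w ≠ v := fun w hw ↦ by
    rw [Finset.mem_singleton] at hw
    subst hw
    exact hne
  obtain ⟨u, hunr, haway, hev⟩ := exists_mem_unramifiedOutside_forall_resOfLe_conjH1_eq_of_SUR S hS κ ρ₀ ψ hψ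
    hv hSUR hA hF {vbar} hvbarS hvbarv (fun _ ↦ c)
    (fun w hw ↦ by rw [Finset.mem_singleton] at hw; subst hw; exact hcd)
    (fun w hw ↦ by rw [Finset.mem_singleton] at hw; subst hw; exact hc) (fun _ i ↦ γ ^ i) hσrep y'
  refine ⟨u, ?_, fun w hw hpw σ ↦ ?_, fun i hi ↦ (hev vbar (Finset.mem_singleton_self vbar) i hi).trans (hy' i)⟩
  · -- unramified outside `{v̄} ∪ {w ∣ p}` ⇒ unramified outside `Sf ∪ {w ∣ p}`
    rw [mem_unramifiedOutside_iff] at hunr ⊢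
    intro w _ hpw σ
    exact hunr w (fun hw ↦ hpw (by
      rw [Finset.coe_singleton, Set.mem_singleton_iff] at hw
      exact hw ▸ hvbar)) hpw σ
  · -- locally trivial above `w ∈ Sf`, `w ∤ p`
    refine haway w (hSfS w hw) (fun h' ↦ hpw (h' ▸ hv)) (fun hw' ↦ ?_) σ
    rw [Finset.mem_singleton] at hw'
    exact hpw (hw' ▸ hvbar)

/-- **[T28 `OfTate` re-typing: Greenberg 2006 Prop. 3.2 by name ↦ Milne ADT I Thm. 5.1 by name (Prop. 3.2 is read in degrees ≤ 2 only, `prop32_global_le_two_of_tate`).]** [cite: MilneADT2006, I Thm. 5.1 (p. 67)] **S1 in the `hsur` currency from one torsion datum at `Sf`**: as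
`char_exists_forall_resOfLe_conjH1_pow_eq_at_vbar_of_datum_ofTate`, for families `y : Fin (p^c) → …` and all
`i : Fin (p^c)`, `τ i = γ^i`. [cite: Greenberg2016Selmer, Prop. 2.6.3 (c)] [cite: KellerYin2024, Rem. 1.4.2 (arXiv:2402.12781v2 TeX L1130–1140)] -/
theorem char_forall_fin_exists_unramifiedOutside_resOfLe_conjH1_pow_eq_of_datum_ofTate (h263 : prop263_sur_of_crk)
    (h41 : prop41_globalEulerPoincareCorank) (h42 : prop42_localEulerPoincareCorank)
    (h5A : sec5A_localH2_subsingleton_of_LOC1) (h32 : (∀ (L : Type) [Field L] [NumberField L], Literature.NumberTheory.GaloisCohomology.tateGlobalEulerPoincareCharacteristic L))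
    (W : WeierstrassCurve ℚ) [W.IsElliptic] (hp : 2 < p) (hK : IsImaginaryQuadratic K)
    (hH : SatisfiesHeegnerHypothesis (W.conductorNorm ℤ) K)
    {ι : K →+* ℚ_[p]} {v vbar : HeightOneSpectrum (𝓞 K)}
    (hvι : ∀ x : 𝓞 K, x ∈ v.asIdeal ↔ ‖ι (x : K)‖ < 1)
    (hvbar : ((p : ℕ) : 𝓞 K) ∈ vbar.asIdeal) (hne : vbar ≠ v)
    (κ : ZpExtension K p) (hκ : κ.IsAnticyclotomic) (γ : absoluteGaloisGroup K)
    [Fact (κ.IsTopGenerator γ)]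
    {θsub θquot : FramedGaloisRep K (padicCoeffIntegers (∅ : Set (PadicAlgCl p))) 1}
    (hpair : IsResidualPairOver (W.baseChange K) p θsub θquot)
    (Sf : Finset (HeightOneSpectrum (𝓞 K)))
    (hSf : ∀ w : HeightOneSpectrum (𝓞 K), w ∈ Sf ↔ ((W.conductorNorm ℤ : ℤ) : 𝓞 K) ∈ w.asIdeal)
    (θ : FramedGaloisRep K (padicCoeffIntegers (∅ : Set (PadicAlgCl p))) 1) (hθ : θ = θsub ∨ θ = θquot)
    (D : DatumDualData κ γ (charModule (∅ : Set (PadicAlgCl p)) θ)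
      (Castella2018.AcSelmer.bdpData (charModule (∅ : Set (PadicAlgCl p)) θ) p vbar) (↑Sf : Set (HeightOneSpectrum (𝓞 K))))
    (hDfin : Module.Finite (IwasawaAlgebra p) D.X) (hDtor : Module.IsTorsion (IwasawaAlgebra p) D.X)
    (c : ℕ) (hc : ∃ δ ∈ decomp (K := K) vbar, (κ δ).toAdd = (p : ℤ_[p]) ^ c)
    (hcd : ∀ δ ∈ decomp (K := K) vbar, (p : ℤ_[p]) ^ c ∣ (κ δ).toAdd) :
    ∀ y : Fin (p ^ c) →
        subgroupH1 (κ.kerSubgroup ⊓ decomp (K := K) vbar) (charModule (∅ : Set (PadicAlgCl p)) θ),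
      ∃ u ∈ unramifiedOutside κ.kerSubgroup (charModule (∅ : Set (PadicAlgCl p)) θ) p (↑Sf : Set (HeightOneSpectrum (𝓞 K))),
        ∀ i : Fin (p ^ c),
          resOfLe (charModule (∅ : Set (PadicAlgCl p)) θ)
            (inf_le_left : κ.kerSubgroup ⊓ decomp (K := K) vbar ≤ κ.kerSubgroup)
            (conjH1 κ.kerSubgroup (charModule (∅ : Set (PadicAlgCl p)) θ) (γ ^ (i : ℕ)) u) = y i :=
  forall_fin_of_forall_nat
    (fun u ↦ u ∈ unramifiedOutside κ.kerSubgroup (charModule (∅ : Set (PadicAlgCl p)) θ) p (↑Sf : Set (HeightOneSpectrum (𝓞 K))))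
    (fun i u ↦ resOfLe (charModule (∅ : Set (PadicAlgCl p)) θ)
      (inf_le_left : κ.kerSubgroup ⊓ decomp (K := K) vbar ≤ κ.kerSubgroup)
      (conjH1 κ.kerSubgroup (charModule (∅ : Set (PadicAlgCl p)) θ) (γ ^ i) u))
    fun y ↦ by
      obtain ⟨u, hu, -, hev⟩ := char_exists_forall_resOfLe_conjH1_pow_eq_at_vbar_of_datum_ofTate h263 h41 h42 h5A
        h32 W hp hK hH hvι hvbar hne κ hκ γ hpair Sf hSf θ hθ D hDfin hDtor c hc hcd y
      exact ⟨u, hu, hev⟩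

/-- **[T28 `OfTate` re-typing: Greenberg 2006 Prop. 3.2 by name ↦ Milne ADT I Thm. 5.1 by name (Prop. 3.2 is read in degrees ≤ 2 only, `prop32_global_le_two_of_tate`).]** [cite: MilneADT2006, I Thm. 5.1 (p. 67)] **S2 in the `hsur` currency from the cotorsion of `X_ac^{Sf}`**: as
`curve_exists_forall_resOfLe_conjH1_pow_eq_at_vbar_of_xAc_ofTate`, for families `y : Fin (p^c) → …` and all
`i : Fin (p^c)`, `τ i = γ^i`. [cite: Greenberg2016Selmer, Prop. 2.6.3 (c)] [cite: KellerYin2024, Rem. 1.4.2 (arXiv:2402.12781v2 TeX L1130–1140)] -/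
theorem curve_forall_fin_exists_unramifiedOutside_resOfLe_conjH1_pow_eq_of_xAc_ofTate (h263 : prop263_sur_of_crk)
    (h41 : prop41_globalEulerPoincareCorank) (h42 : prop42_localEulerPoincareCorank)
    (h5A : sec5A_localH2_subsingleton_of_LOC1) (h32 : (∀ (L : Type) [Field L] [NumberField L], Literature.NumberTheory.GaloisCohomology.tateGlobalEulerPoincareCharacteristic L))
    (W : WeierstrassCurve ℚ) [W.IsElliptic] (hp : 2 < p) (hK : IsImaginaryQuadratic K)
    (hH : SatisfiesHeegnerHypothesis (W.conductorNorm ℤ) K)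
    {ι : K →+* ℚ_[p]} {v vbar : HeightOneSpectrum (𝓞 K)}
    (hvι : ∀ x : 𝓞 K, x ∈ v.asIdeal ↔ ‖ι (x : K)‖ < 1)
    (hvbar : ((p : ℕ) : 𝓞 K) ∈ vbar.asIdeal) (hne : vbar ≠ v)
    (κ : ZpExtension K p) (hκ : κ.IsAnticyclotomic) (γ : absoluteGaloisGroup K)
    [Fact (κ.IsTopGenerator γ)]
    (Sf : Finset (HeightOneSpectrum (𝓞 K)))
    (hSf : ∀ w : HeightOneSpectrum (𝓞 K), w ∈ Sf ↔ ((W.conductorNorm ℤ : ℤ) : 𝓞 K) ∈ w.asIdeal)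
    (hXfin : Module.Finite (IwasawaAlgebra p) (XAc (W.baseChange K) p κ vbar (↑Sf : Set (HeightOneSpectrum (𝓞 K))) γ))
    (hXtor : Module.IsTorsion (IwasawaAlgebra p) (XAc (W.baseChange K) p κ vbar (↑Sf : Set (HeightOneSpectrum (𝓞 K))) γ))
    (c : ℕ) (hc : ∃ δ ∈ decomp (K := K) vbar, (κ δ).toAdd = (p : ℤ_[p]) ^ c)
    (hcd : ∀ δ ∈ decomp (K := K) vbar, (p : ℤ_[p]) ^ c ∣ (κ δ).toAdd) :
    ∀ y : Fin (p ^ c) →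
        subgroupH1 (κ.kerSubgroup ⊓ decomp (K := K) vbar) ((W.baseChange K).geomPrimaryTorsion p),
      ∃ u ∈ unramifiedOutside κ.kerSubgroup ((W.baseChange K).geomPrimaryTorsion p) p (↑Sf : Set (HeightOneSpectrum (𝓞 K))),
        ∀ i : Fin (p ^ c),
          resOfLe ((W.baseChange K).geomPrimaryTorsion p)
            (inf_le_left : κ.kerSubgroup ⊓ decomp (K := K) vbar ≤ κ.kerSubgroup)
            (conjH1 κ.kerSubgroup ((W.baseChange K).geomPrimaryTorsion p) (γ ^ (i : ℕ)) u) = y i :=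
  forall_fin_of_forall_nat
    (fun u ↦ u ∈ unramifiedOutside κ.kerSubgroup ((W.baseChange K).geomPrimaryTorsion p) p (↑Sf : Set (HeightOneSpectrum (𝓞 K))))
    (fun i u ↦ resOfLe ((W.baseChange K).geomPrimaryTorsion p)
      (inf_le_left : κ.kerSubgroup ⊓ decomp (K := K) vbar ≤ κ.kerSubgroup)
      (conjH1 κ.kerSubgroup ((W.baseChange K).geomPrimaryTorsion p) (γ ^ i) u))
    fun y ↦ by
      obtain ⟨u, hu, -, hev⟩ := curve_exists_forall_resOfLe_conjH1_pow_eq_at_vbar_of_xAc_ofTate h263 h41 h42 h5A h32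
        W hp hK hH hvι hvbar hne κ hκ γ Sf hSf hXfin hXtor c hc hcd y
      exact ⟨u, hu, hev⟩

end SurAtVbarOfDatum

end Summit.BirchSwinnertonDyer.BirchSwinnertonDyer.Theorems.AcTwistDeformation

end
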